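import Literature.MathematicalPhysics.QuantumFieldTheory.Balaban1983to89.Beta.RootedKernelReflection
import Summits.QuantumFields.BalabanUV.Beta.GAN24.FibreSymbols
import Summits.QuantumFields.BalabanUV.Beta.GAN24.AliasWeights

/-!
# `BalabanUV.Beta.GAN24.AveragingContourSymbols` — binder row G-an2-4 / (CONV-C), S-slot road «S3-fibre²», register tag «ALIAS-SYMBOL-VH*» part 1
# (typer T-E6 (u2); SKELETON-S3 §8 (I-L3)(b); cut R5): the FIRST-JET ∕ AXIAL pieces of an1's one-step averaging letters ON PLANE WAVES —
# B7's (14)-linearisation `linAvg` with its AXIAL TAILS as an explicit trigonometric polynomial, and the ordered double sum (`wedge`) of a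
# plane-wave pair along one straight segment (the first brick of the W-Hessian table)

NOT IN PRINT; OUR PROOF ATTEMPT (unit b2b-balaban-gan24-formalise-leaf-10, gen 11; NEUTRAL name outside `StencilSlot*`; drafted in records, FILED on the row owner's
«go (as `GAN24/AveragingContourSymbols`)», gan24-p1-g4 RULINGS-4, CLAIMS l.4423; the rooted twins ∕ signed segments of part 1b stay in records until their own «go»).  HONEST FRAMING (cell contract, verbatim): «discharging `BetaPertH` makes Bałaban's UV stability UNCONDITIONAL —
a real constructive-QFT result; it is NOT the continuum limit and NOT the Clay problem.»  HONEST DEPENDENCY (verbatim): «continuum YM on T⁴ ⇐ BetaPertH ∧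
nine spine estimates (0/9 proved); BetaPertH ⇐ (D1) ∧ (D4) ∧ CAP+tail; G-an2-4 gates asym, D1 and NE2/3/4.»  [folklore] finite trigonometric sums over node 5's
letter lists (`Beta.AveragingContours`: `segUp`, `axial`, `Lam`, `linAvg`; wedge algebra from `Beta.RootedKernelReflection`) and road P1's plane waves (`GAN24/FibreSymbols`: `pw`, `pw1`, `gsum`); generic
dimension; 0 cite, 0 `def … : Prop`, no estimate, nothing about `e3Of`'s size; NOTHING of (hS, hSall) ∕ «E3Shape» is discharged.  NOT summit progress.

WHAT IS PROVED (all on the plane-wave one-form `pw1 k v κ x = v κ · e^{i k·x}`, complex momentum `k`, polarisation `v`):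
* §1 `gsum2 z L := Σ_{t<L} gsum z t` (the double geometric sum) with `gsum2_mul : gsum2 z L · (e^{iz} − 1) = gsum z L − L` (`AliasWeights.geomExp_mul_sub_one` BY NAME).
* §2 `segUp_sum_plane : (segUp (pw1 k v) z κ n).sum = v κ · pw k z · gsum (k κ) n` (node 5's straight segment; cf. `FibreSymbols.contourSum_plane`).
* §3 `axial_sum_plane`: the AXIAL contour `Γ_{y, y+b}` (B7 p. 24; node 5's coordinate order: the segment moving coordinate `j` starts with the coordinates
  `i > j` already moved) sums to `pw k y · Σ_j v j · gsum (k j) (b j) · Π_{i > j} e^{i k_i b_i}`.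
* §4 `Lam_plane`: the block axial potential `Λ(y) = Σ_{x∈B(y)} A(Γ_{L·y,x})` is `pw k (L•y) · Σ_j v j · axA k L j`, `axA k L j = Π_i axFac k L j i` with the per-coordinate
  factors `gsum (k i) L` (`i > j`), `gsum2 (k j) L` (`i = j`), `L` (`i < j`).
* §5 `linAvg_plane`: B7's (14) `linAvg = contourSum + (Λ(y) − Λ(y + e_μ))` (node 5 `linAvg_eq_straight_sub_grad`) on plane waves:
  `pw k (L•y) · ( v μ · (Π_i gsum (k i) L) · gsum (k μ) L + (1 − e^{i L k_μ}) · Σ_j v j · axA k L j )` — the (1.11) symbol (`contourSum_plane`) plus a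
  PURE COARSE-GAUGE tail (factor `1 − e^{iLk_μ}`, `= 1 − e^{ip_μ}` on the alias momenta `k = (p + 2πm)/L`).
* §6 `wedge_segUp_plane` (with an1's `RootedKernelReflection.wedge_append` BY NAME): the integer wedge `Σ_{i<j}(a_i b_j − b_i a_j)` of `AveragingHessianKernels` on ONE straight
  segment of a plane-wave PAIR: `v κ · v′ κ · pw k z · pw k′ z · (ordGsum (k κ) (k′ κ) n − ordGsum (k′ κ) (k κ) n)`, `ordGsum a b n := Σ_{t<n} e^{ibt} · gsum a t` (ordered double sum).
These are the (L-seg)∕(L-ax)∕(L-Lam)∕(L-q)∕(L-wedge) lines of `HOME/b2b-balaban-gan24-formalise-leaf-10/g11/engine/E3-SUBSYMBOL-SOURCES.md` §5.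
-/

noncomputable section

open Complex Finset
open scoped BigOperators
open Literature.MathematicalPhysics.QuantumFieldTheory.Balaban1983to89.Beta
open AffineAveraging (Site Form1 unitVec unitVec_apply toSite box contourSum)
open AveragingContours (segUp segUp_succ segUp_zero seg corner axialAux axial Lam linAvg linAvg_eq_straight_sub_grad straightSum_eq_contourSum)
open TransportedContourVariables (pairForm pairForm_apply bg fl bg_segUp_pairForm fl_segUp_pairForm)
open AveragingHessianKernels (wedge wedge_nil wedge_cons)
open Summit.QuantumFields.BalabanUV.Beta.GAN24.FibreSymbols (pw pw1 gsum pw_add pw_natSmul_unitVec pw_toSite contourSum_plane)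

namespace Summit.QuantumFields.BalabanUV.Beta.GAN24.AveragingContourSymbols

variable {D : ℕ}

/-! ## §1 The double geometric sum -/

/-- [folklore] `gsum2 z L := Σ_{t<L} gsum z t = Σ_{s<t<L} e^{izs}` — the box-sum of partial geometric sums met by the axial tails. -/
def gsum2 (z : ℂ) (L : ℕ) : ℂ := ∑ t ∈ Finset.range L, gsum z t

/-- [folklore] `gsum z (n+1) = gsum z n + e^{izn}`. -/
theorem gsum_succ (z : ℂ) (n : ℕ) : gsum z (n + 1) = gsum z n + cexp (I * z * (n : ℂ)) := by
  simp [gsum, Finset.sum_range_succ]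

/-- [folklore] Closed form of the double geometric sum off `z ∈ 2πℤ`: `gsum2 z L · (e^{iz} − 1) = gsum z L − L` (the geometric-sum identity
`AliasWeights.geomExp_mul_sub_one` BY NAME, = `AliasStripSymbolsSum.gsum_mul_sub_one`). -/
theorem gsum2_mul (z : ℂ) (L : ℕ) : gsum2 z L * (cexp (I * z) - 1) = gsum z L - L := by
  have h : ∀ t : ℕ, gsum z t * (cexp (I * z) - 1) = cexp (I * z * (t : ℂ)) - 1 := fun t => AliasWeights.geomExp_mul_sub_one z t
  unfold gsum2
  rw [Finset.sum_mul, Finset.sum_congr rfl fun t _ => h t, Finset.sum_sub_distrib]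
  simp [gsum]

/-! ## §2 One straight segment -/

/-- [folklore] **STRAIGHT SEGMENT ON A PLANE WAVE**: `Σ_{s<n} v κ e^{ik·(z + s e_κ)} = v κ · e^{ik·z} · gsum (k κ) n`. -/
theorem segUp_sum_plane (k : Fin D → ℂ) (v : Fin D → ℂ) (z : Site D) (κ : Fin D) (n : ℕ) :
    (segUp (pw1 k v) z κ n).sum = v κ * pw k z * gsum (k κ) n := by
  induction n with
  | zero => simp [gsum]
  | succ n ih =>
    rw [segUp_succ, List.sum_append, List.sum_singleton, ih, gsum_succ]
    simp only [pw1, pw_add, pw_natSmul_unitVec]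
    ring

/-- [folklore] The signed segment of nonnegative length is the forward segment. -/
theorem seg_of_nonneg (A : Form1 D ℂ) (z : Site D) (κ : Fin D) {n : ℤ} (hn : 0 ≤ n) : seg A z κ n = segUp A z κ n.toNat := by
  simp [seg, hn]

/-! ## §3 The axial contour `Γ_{y, y+b}` -/

/-- [folklore] The intermediate corner of `Γ_{y, y+b}` at stage `m`: coordinates `i ≥ m` already at `y_i + b_i`, the others at `y_i`. -/
theorem corner_eq_add_toSite (y : Site D) (b : Fin D → ℕ) (m : ℕ) :
    corner y (y + toSite b) m = y + toSite (fun i => if m ≤ (i : ℕ) then b i else 0) := by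
  funext j
  simp only [corner, Pi.add_apply, toSite]
  split_ifs <;> simp

/-- [folklore] The plane wave at a truncated offset: `pw k (toSite (i ↦ [m ≤ i] b_i)) = Π_{i : m ≤ i} e^{i k_i b_i}`. -/
theorem pw_toSite_trunc (k : Fin D → ℂ) (b : Fin D → ℕ) (m : ℕ) :
    pw k (toSite (fun i => if m ≤ (i : ℕ) then b i else 0)) = ∏ i ∈ univ.filter (fun i : Fin D => m ≤ (i : ℕ)), cexp (I * k i * (b i : ℂ)) := by
  rw [pw_toSite, Finset.prod_filter]
  refine Finset.prod_congr rfl fun i _ => ?_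
  split_ifs <;> simp

/-- [folklore] The axial term of coordinate `j`: `v j · gsum (k j) (b j) · Π_{i > j} e^{i k_i b_i}`. -/
def axTerm (k : Fin D → ℂ) (v : Fin D → ℂ) (b : Fin D → ℕ) (j : Fin D) : ℂ :=
  v j * gsum (k j) (b j) * ∏ i ∈ univ.filter (fun i : Fin D => (j : ℕ) + 1 ≤ (i : ℕ)), cexp (I * k i * (b i : ℂ))

/-- [folklore] Partial axial contour on a plane wave (stages `< m`). -/
theorem axialAux_sum_plane (k : Fin D → ℂ) (v : Fin D → ℂ) (y : Site D) (b : Fin D → ℕ) :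
    ∀ m, m ≤ D → (axialAux (pw1 k v) y (y + toSite b) m).sum
      = pw k y * ∑ j ∈ Finset.range m, (if h : j < D then axTerm k v b ⟨j, h⟩ else 0)
  | 0, _ => by simp [axialAux]
  | m + 1, hm => by
    have h : m < D := by omega
    have hlen : (y + toSite b) ⟨m, h⟩ - y ⟨m, h⟩ = (b ⟨m, h⟩ : ℤ) := by simp [toSite]
    simp only [axialAux, h, dif_pos, List.sum_append]
    rw [axialAux_sum_plane k v y b m (by omega), hlen, seg_of_nonneg _ _ _ (by positivity), Int.toNat_natCast,
      segUp_sum_plane, corner_eq_add_toSite, pw_add, pw_toSite_trunc, Finset.sum_range_succ, dif_pos h]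
    simp only [axTerm]
    ring

/-- [folklore] **THE AXIAL CONTOUR ON A PLANE WAVE**: `A(Γ_{y, y+b}) = pw k y · Σ_j axTerm k v b j` for `A = pw1 k v`. -/
theorem axial_sum_plane (k : Fin D → ℂ) (v : Fin D → ℂ) (y : Site D) (b : Fin D → ℕ) :
    (axial (pw1 k v) y (y + toSite b)).sum = pw k y * ∑ j : Fin D, axTerm k v b j := by
  rw [axial, axialAux_sum_plane k v y b D le_rfl,
    ← Fin.sum_univ_eq_sum_range (fun j => if h : j < D then axTerm k v b ⟨j, h⟩ else 0) D]
  congr 1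
  refine Finset.sum_congr rfl fun j _ => ?_
  simp [j.2]

/-! ## §4 The block axial potential `Λ(y) = Σ_{x ∈ B(y)} A(Γ_{L·y, x})` -/

/-- [folklore] The per-coordinate factor of the box-summed axial term of coordinate `j`: `gsum (k i) L` for `i > j` (coordinate already moved:
a full phase sum), `gsum2 (k j) L` for `i = j` (the partial segment, summed over its length), `L` for `i < j` (coordinate not yet moved: no phase). -/
def axFac (k : Fin D → ℂ) (L : ℕ) (j i : Fin D) : ℂ :=
  if (j : ℕ) + 1 ≤ (i : ℕ) then gsum (k i) L else if i = j then gsum2 (k j) L else (L : ℂ)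

/-- [folklore] The box-summed axial factor of coordinate `j`: `axA k L j = Π_i axFac k L j i`. -/
def axA (k : Fin D → ℂ) (L : ℕ) (j : Fin D) : ℂ := ∏ i : Fin D, axFac k L j i

/-- [folklore] The summand of the axial term as a product over coordinates. -/
theorem axTerm_eq_prod (k : Fin D → ℂ) (v : Fin D → ℂ) (b : Fin D → ℕ) (j : Fin D) :
    axTerm k v b j = v j * ∏ i : Fin D,
      (if (j : ℕ) + 1 ≤ (i : ℕ) then cexp (I * k i * (b i : ℂ)) else if i = j then gsum (k i) (b i) else 1) := by
  unfold axTerm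
  rw [mul_assoc]
  congr 1
  rw [← Finset.prod_filter_mul_prod_filter_not univ (fun i : Fin D => (j : ℕ) + 1 ≤ (i : ℕ))]
  have h1 : ∏ i ∈ univ.filter (fun i : Fin D => (j : ℕ) + 1 ≤ (i : ℕ)),
      (if (j : ℕ) + 1 ≤ (i : ℕ) then cexp (I * k i * (b i : ℂ)) else if i = j then gsum (k i) (b i) else 1)
      = ∏ i ∈ univ.filter (fun i : Fin D => (j : ℕ) + 1 ≤ (i : ℕ)), cexp (I * k i * (b i : ℂ)) :=
    Finset.prod_congr rfl fun i hi => by rw [Finset.mem_filter] at hi; rw [if_pos hi.2]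
  have h2 : ∏ i ∈ univ.filter (fun i : Fin D => ¬ ((j : ℕ) + 1 ≤ (i : ℕ))),
      (if (j : ℕ) + 1 ≤ (i : ℕ) then cexp (I * k i * (b i : ℂ)) else if i = j then gsum (k i) (b i) else 1) = gsum (k j) (b j) := by
    rw [Finset.prod_eq_single_of_mem j (by simp)]
    · simp
    · intro i hi hij
      rw [Finset.mem_filter] at hi
      rw [if_neg hi.2, if_neg hij]
  rw [h1, h2, mul_comm]

/-- [folklore] The box sum of the per-coordinate factors: `Σ_{t<L}` of the three cases. -/
theorem sum_range_axFac (k : Fin D → ℂ) (L : ℕ) (j i : Fin D) :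
    ∑ t ∈ Finset.range L, (if (j : ℕ) + 1 ≤ (i : ℕ) then cexp (I * k i * (t : ℂ)) else if i = j then gsum (k i) t else 1) = axFac k L j i := by
  unfold axFac
  split_ifs with h1 h2
  · rfl
  · subst h2; rfl
  · simp

/-- [folklore] **THE BLOCK AXIAL POTENTIAL ON A PLANE WAVE**: `Λ(y) = pw k (L•y) · Σ_j v j · axA k L j` for `A = pw1 k v`. -/
theorem Lam_plane (k : Fin D → ℂ) (v : Fin D → ℂ) (L : ℕ) (y : Site D) :
    Lam (pw1 k v) L y = pw k ((L : ℤ) • y) * ∑ j : Fin D, v j * axA k L j := by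
  unfold AveragingContours.Lam
  simp_rw [axial_sum_plane, ← Finset.mul_sum]
  congr 1
  rw [Finset.sum_comm]
  refine Finset.sum_congr rfl fun j _ => ?_
  simp_rw [axTerm_eq_prod, ← Finset.mul_sum]
  congr 1
  unfold axA AffineAveraging.box
  rw [Finset.sum_prod_piFinset (Finset.range L)
    (fun (i : Fin D) (t : ℕ) => if (j : ℕ) + 1 ≤ (i : ℕ) then cexp (I * k i * (t : ℂ)) else if i = j then gsum (k i) t else 1)]
  exact Finset.prod_congr rfl fun i _ => sum_range_axFac k L j i

/-! ## §5 B7's (14)-linearisation `linAvg` on a plane wave: the (1.11) symbol plus a pure coarse-gauge tail -/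

/-- [folklore] `pw k (L • (y + e_μ)) = pw k (L•y) · e^{i k_μ L}`. -/
theorem pw_zsmul_add_unitVec (k : Fin D → ℂ) (L : ℕ) (y : Site D) (μ : Fin D) :
    pw k ((L : ℤ) • (y + unitVec μ)) = pw k ((L : ℤ) • y) * cexp (I * k μ * (L : ℂ)) := by
  rw [smul_add, pw_add, pw_natSmul_unitVec]

/-- [folklore] **B7 (14) ON A PLANE WAVE** (`q̂`, the first-jet symbol with axial tails):
`linAvg (pw1 k v) L μ y = pw k (L•y) · ( v μ · (Π_i gsum (k i) L) · gsum (k μ) L + (1 − e^{i k_μ L}) · Σ_j v j · axA k L j )`. -/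
theorem linAvg_plane (k : Fin D → ℂ) (v : Fin D → ℂ) (L : ℕ) (μ : Fin D) (y : Site D) :
    linAvg (pw1 k v) L μ y = pw k ((L : ℤ) • y) *
      (v μ * (∏ i, gsum (k i) L) * gsum (k μ) L + (1 - cexp (I * k μ * (L : ℂ))) * ∑ j : Fin D, v j * axA k L j) := by
  rw [linAvg_eq_straight_sub_grad, straightSum_eq_contourSum, contourSum_plane, Lam_plane, Lam_plane, pw_zsmul_add_unitVec]
  ring

/-! ## §6 The wedge of a plane-wave pair along one straight segment -/

section Wedge

variable {R : Type*} [CommRing R]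

-- The concatenation law `wedge (l₁ ++ l₂) = wedge l₁ + wedge l₂ + (Σ bg l₁ · Σ fl l₂ − Σ fl l₁ · Σ bg l₂)` and `wedge (rev l) = −wedge l` are
-- an1's `RootedKernelReflection.wedge_append` / `wedge_rev` (imported BY NAME; a local twin would bounce `dedup.landed`).

/-- [folklore] The wedge of a singleton vanishes. -/
@[simp] theorem wedge_singleton (p : R × R) : wedge [p] = 0 := by simp [bg, fl]

end Wedge

/-- [folklore] The ORDERED DOUBLE GEOMETRIC SUM `ordGsum a b n := Σ_{t<n} e^{ibt} · gsum a t = Σ_{s<t<n} e^{ias} e^{ibt}`. -/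
def ordGsum (a b : ℂ) (n : ℕ) : ℂ := ∑ t ∈ Finset.range n, cexp (I * b * (t : ℂ)) * gsum a t

/-- [folklore] `ordGsum a b (n+1) = ordGsum a b n + e^{ibn} · gsum a n`. -/
theorem ordGsum_succ (a b : ℂ) (n : ℕ) : ordGsum a b (n + 1) = ordGsum a b n + cexp (I * b * (n : ℂ)) * gsum a n := by
  simp [ordGsum, Finset.sum_range_succ]

/-- [folklore] **THE WEDGE OF A PLANE-WAVE PAIR ALONG ONE STRAIGHT SEGMENT** (background letters `pw1 k v`, fluctuation letters `pw1 k′ v′`):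
`wedge (segUp (pairForm (pw1 k v) (pw1 k′ v′)) z κ n) = v κ · v′ κ · pw k z · pw k′ z · (ordGsum (k κ) (k′ κ) n − ordGsum (k′ κ) (k κ) n)`. -/
theorem wedge_segUp_plane (k k' : Fin D → ℂ) (v v' : Fin D → ℂ) (z : Site D) (κ : Fin D) (n : ℕ) :
    wedge (segUp (pairForm (pw1 k v) (pw1 k' v')) z κ n)
      = v κ * v' κ * pw k z * pw k' z * (ordGsum (k κ) (k' κ) n - ordGsum (k' κ) (k κ) n) := by
  induction n with
  | zero => simp [ordGsum]
  | succ n ih =>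
    rw [segUp_succ, RootedKernelReflection.wedge_append, ih, wedge_singleton, bg_segUp_pairForm, fl_segUp_pairForm, segUp_sum_plane, segUp_sum_plane,
      ordGsum_succ, ordGsum_succ]
    simp only [bg, fl, List.map_cons, List.map_nil, List.sum_cons, List.sum_nil, add_zero, pairForm_apply, pw1, pw_add,
      pw_natSmul_unitVec]
    ring

end Summit.QuantumFields.BalabanUV.Beta.GAN24.AveragingContourSymbols

end
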